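import Summits.HubbardSuperconductivity.HubbardSuperconductivity.Theses.FunctionFieldCertificate
import Summits.HubbardSuperconductivity.HubbardSuperconductivity.Theorems.TwTipContinuation.Negative.TipNormalForm
import Summits.HubbardSuperconductivity.HubbardSuperconductivity.Theorems.BalabanIRBirEveryGroundStateAffine

/-!
# Route `FunctionFieldCertificate` — support item `CertificateSoundness` (stmt-HubbardSuperconductivity-7333)

`CertifiedSectorLRO → HubbardSuperconductivity`: SOUNDNESS of the semantic (per-`L`, evaluated)
certificate of the target `CertifiedSectorLRO` — an operator identity
`L⁻⁴ Δ_dᴴ Δ_d − (a − C/L)·1 = Σ Oᵢᴴ Oᵢ + Σ Qᵢᴴ (H Qᵢ − Qᵢ H) + (H R − R H) + T` on the Fock space of the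
torus `(ℤ/Lℤ)²`, `H = hubbardTorus 2 L 1 U`, with sector-preserving `Qᵢ` and a sector term `T` of zero
expectation on `szSector N_L 0` — in every normalised `(N_L, S^z = 0)`-sector ground state.

* `re_expect_certificate_nonneg` — the abstract soundness step, for ANY Hermitian `H`, sector `K`
  and `ψ ∈ K` with `H ψ = (minEnergyOn H K) • ψ`:
  `0 ≤ re ⟨ψ, (Σ Oᵢᴴ Oᵢ + Σ Qᵢᴴ (H Qᵢ − Qᵢ H) + (H R − R H) + T) ψ⟩`, because
  `⟨ψ, Oᴴ O ψ⟩ = ‖O ψ‖² ≥ 0`; `⟨ψ, Qᴴ (H Q − Q H) ψ⟩ = ⟨Q ψ, H Q ψ⟩ − E₀ ‖Q ψ‖² ≥ 0` by the variational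
  principle in the sector (`Q ψ ∈ K`, `E₀ = minEnergyOn H K`); `⟨ψ, (H R − R H) ψ⟩ = E₀⟨ψ,Rψ⟩ − E₀⟨ψ,Rψ⟩ = 0`
  by Hermiticity of `H` and reality of `E₀`; `⟨ψ, T ψ⟩ = 0` by hypothesis.
* `le_re_of_certificate` — evaluating an identity `c • P − r • 1 = certificate` in such a unit vector `ψ`
  gives `r ≤ re (c ⟨ψ, P ψ⟩)`.
* `certificateSoundness_proof` — with `r = a − C/L ≥ a/2` for `L ≥ ⌈2C/a⌉`, the every-ground-state floor
  `(a/2) L⁴ ≤ re ⟨ψ, Δ_dᴴ Δ_d ψ⟩` holds at all large even `L`, and the summit's matrix at `(U, δ)` is the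
  tree's floor-to-LRO bookkeeping `TwTipContinuation.Negative.summitMatrix_of_everyGSOrder`
  (`Σ_{x,y} G_L(x,y) = re ⟨ψ_L, Δᴴ Δ ψ_L⟩` over the fundamental domain, `‖P_x‖²`-boundedness for the
  `liminf` along even sides).

Folklore finite-dimensional linear algebra (Tasaki 2020 §2.1–2.2, variational principle in a sector;
soundness of SOS + first-order/KKT ground-state relaxations in the shape of Wang et al. 2024 and
Fawzi–Fawzi–Scalet 2024). No definition is introduced; all statements are on the literal route terms.
-/

noncomputable section

namespace Summit.HubbardSuperconductivity.HubbardSuperconductivity.Theorems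

open Matrix Finset Filter
open Literature.MathematicalPhysics.QuantumLattice Literature.Probability.LatticeModels
open Summit.HubbardSuperconductivity.HubbardSuperconductivity.Theses.FunctionFieldCertificate
open scoped ComplexOrder

section Abstract

variable {ι : Type*} [Fintype ι]

/-- **Soundness of one evaluated certificate (abstract form).** For a Hermitian `H`, a sector `K`,
sector-preserving `Qᵢ`, a sector term `T` with zero expectation on `K`, an arbitrary `R`, and a vector
`ψ ∈ K` with `H ψ = E₀ ψ`, `E₀ = minEnergyOn H K` (a sector ground state), the expectation of
`Σ Oᵢᴴ Oᵢ + Σ Qᵢᴴ (H Qᵢ − Qᵢ H) + (H R − R H) + T` in `ψ` has nonnegative real part: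
the four terms contribute `‖Oᵢψ‖² ≥ 0`, `⟨Qᵢψ, H Qᵢψ⟩ − E₀‖Qᵢψ‖² ≥ 0` (variational principle in `K`),
`E₀⟨ψ,Rψ⟩ − E₀⟨ψ,Rψ⟩ = 0` and `0`. Tasaki (2020) §2.1–2.2. [folklore] -/
theorem re_expect_certificate_nonneg {H : Matrix ι ι ℂ} (hH : H.IsHermitian)
    (K : Submodule ℂ (ι → ℂ)) {n m : ℕ} (O : Fin n → Matrix ι ι ℂ) (Q : Fin m → Matrix ι ι ℂ)
    (R T : Matrix ι ι ℂ) (hQ : ∀ (i : Fin m) (φ : ι → ℂ), φ ∈ K → Q i *ᵥ φ ∈ K)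
    (hT : ∀ φ : ι → ℂ, φ ∈ K → star φ ⬝ᵥ T *ᵥ φ = 0) {ψ : ι → ℂ} (hψK : ψ ∈ K)
    (hHψ : H *ᵥ ψ = ((H.minEnergyOn K : ℝ) : ℂ) • ψ) :
    0 ≤ (star ψ ⬝ᵥ
      (∑ i, (O i)ᴴ * O i + ∑ i, (Q i)ᴴ * (H * Q i - Q i * H) + (H * R - R * H) + T) *ᵥ ψ).re := by
  -- the SOS terms
  have hO : ∀ i, 0 ≤ (star ψ ⬝ᵥ ((O i)ᴴ * O i) *ᵥ ψ).re := fun i => by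
    rw [← mulVec_mulVec, dotProduct_mulVec, ← star_mulVec]
    exact EigenvalueContinuation.re_star_dotProduct_self_nonneg _
  -- the KKT terms
  have hQ' : ∀ i, 0 ≤ (star ψ ⬝ᵥ ((Q i)ᴴ * (H * Q i - Q i * H)) *ᵥ ψ).re := fun i => by
    rw [← mulVec_mulVec, dotProduct_mulVec, ← star_mulVec, sub_mulVec, ← mulVec_mulVec,
      ← mulVec_mulVec, hHψ, mulVec_smul, dotProduct_sub, dotProduct_smul, Complex.sub_re,
      smul_eq_mul, Complex.re_ofReal_mul]
    have h := minEnergyOn_mul_re_le H K (hQ i ψ hψK)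
    linarith
  -- the commutator term
  have hstar : star ψ ᵥ* H = star (H *ᵥ ψ) := by
    rw [star_mulVec, hH.eq]
  have hR : (star ψ ⬝ᵥ (H * R - R * H) *ᵥ ψ).re = 0 := by
    rw [sub_mulVec, ← mulVec_mulVec, ← mulVec_mulVec, dotProduct_sub,
      dotProduct_mulVec (star ψ) H (R *ᵥ ψ), hstar, hHψ, mulVec_smul, dotProduct_smul, star_smul,
      smul_dotProduct, Complex.star_def, Complex.conj_ofReal, sub_self, Complex.zero_re]
  -- assemble
  simp only [add_mulVec, sum_mulVec, dotProduct_add, dotProduct_sum, Complex.add_re,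
    Complex.re_sum]
  rw [hR, hT ψ hψK, Complex.zero_re, add_zero, add_zero]
  exact add_nonneg (Finset.sum_nonneg fun i _ => hO i) (Finset.sum_nonneg fun i _ => hQ' i)

/-- **A floor from an evaluated certificate.** If `c • P − r • 1` is a certificate (in the sense of
`re_expect_certificate_nonneg`) then `r ≤ re (c · ⟨ψ, P ψ⟩)` in every normalised sector ground
state `ψ`. [folklore] -/
theorem le_re_of_certificate [DecidableEq ι] {H : Matrix ι ι ℂ} (hH : H.IsHermitian)
    (K : Submodule ℂ (ι → ℂ)) (P : Matrix ι ι ℂ) (c : ℂ) (r : ℝ) {n m : ℕ}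
    (O : Fin n → Matrix ι ι ℂ) (Q : Fin m → Matrix ι ι ℂ) (R T : Matrix ι ι ℂ)
    (hQ : ∀ (i : Fin m) (φ : ι → ℂ), φ ∈ K → Q i *ᵥ φ ∈ K)
    (hT : ∀ φ : ι → ℂ, φ ∈ K → star φ ⬝ᵥ T *ᵥ φ = 0)
    (hId : c • P - (r : ℂ) • (1 : Matrix ι ι ℂ) =
      ∑ i, (O i)ᴴ * O i + ∑ i, (Q i)ᴴ * (H * Q i - Q i * H) + (H * R - R * H) + T)
    {ψ : ι → ℂ} (hψK : ψ ∈ K) (hψ1 : star ψ ⬝ᵥ ψ = 1)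
    (hHψ : H *ᵥ ψ = ((H.minEnergyOn K : ℝ) : ℂ) • ψ) :
    r ≤ (c * (star ψ ⬝ᵥ P *ᵥ ψ)).re := by
  have h := re_expect_certificate_nonneg hH K O Q R T hQ hT hψK hHψ
  rw [← hId, sub_mulVec, smul_mulVec, smul_mulVec, one_mulVec, dotProduct_sub,
    dotProduct_smul, dotProduct_smul, hψ1, smul_eq_mul, smul_eq_mul, mul_one, Complex.sub_re,
    Complex.ofReal_re] at h
  linarith

end Abstract

/-- **`CertificateSoundness`** (stmt-HubbardSuperconductivity-7333): `CertifiedSectorLRO →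
HubbardSuperconductivity`. From the certificate at `(U, δ)` with constants `a > 0`, `C`, `L₀`: in every
normalised `(N_L, 0)`-sector ground state of `hubbardTorus 2 L 1 U`, `L ≥ max L₀ ⌈2C/a⌉` even,
`(a − C/L) L⁴ ≤ re ⟨ψ, Δ_dᴴ Δ_d ψ⟩` (`le_re_of_certificate` with Hermiticity of the torus Hubbard
Hamiltonian, `LiebThm1.hamiltonian_isHermitian`), and `a − C/L ≥ a/2`; the summit's matrix at
`(U, δ)` then follows from the every-ground-state floor by
`TwTipContinuation.Negative.summitMatrix_of_everyGSOrder`. [folklore] -/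
theorem certificateSoundness_proof :
    Summit.HubbardSuperconductivity.HubbardSuperconductivity.Theses.FunctionFieldCertificate.CertificateSoundness := by
  unfold CertificateSoundness
  rintro ⟨U, hU, δ, hδ, a, C, ha, L₀, hcert⟩
  unfold _root_.HubbardSuperconductivity Literature.Hubbard.DWaveSuperconductivityHubbard
  refine ⟨U, hU, δ, hδ, ?_⟩
  refine Summit.HubbardSuperconductivity.TwTipContinuation.Negative.summitMatrix_of_everyGSOrder
    ⟨a / 2, half_pos ha, max L₀ ⌈2 * C / a⌉₊, ?_⟩
  intro L _ hL hE ψ hψ1 hgs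
  obtain ⟨n, m, O, Q, R, T, hQ, hT, hId⟩ := hcert L (le_of_max_le_left hL) hE
  have hH : (hubbardTorus 2 L 1 U).IsHermitian := LiebThm1.hamiltonian_isHermitian _ 1 U
  obtain ⟨hψK, -, hHψ⟩ := hgs
  have hfloor := le_re_of_certificate hH _ _ _ (a - C / (L : ℝ)) O Q R T hQ hT hId hψK hψ1 hHψ
  have hLpos : (0 : ℝ) < (L : ℝ) := Nat.cast_pos.2 (Nat.pos_of_ne_zero (NeZero.ne L))
  have hL4 : (0 : ℝ) < (L : ℝ) ^ 4 := by positivity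
  have hcast : (1 / (L : ℂ) ^ 4) = (((1 / (L : ℝ) ^ 4 : ℝ)) : ℂ) := by push_cast; rfl
  rw [hcast, Complex.re_ofReal_mul, one_div_mul_eq_div, le_div_iff₀ hL4] at hfloor
  -- `C / L ≤ a / 2` for `L ≥ ⌈2C/a⌉`
  have hCL : C / (L : ℝ) ≤ a / 2 := by
    rw [div_le_iff₀ hLpos]
    have h1 : ((⌈2 * C / a⌉₊ : ℕ) : ℝ) ≤ (L : ℝ) := by exact_mod_cast le_of_max_le_right hL
    have h3 : 2 * C / a ≤ (L : ℝ) := (Nat.le_ceil _).trans h1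
    rw [div_le_iff₀ ha] at h3
    nlinarith
  calc a / 2 * (L : ℝ) ^ 4 ≤ (a - C / (L : ℝ)) * (L : ℝ) ^ 4 :=
        mul_le_mul_of_nonneg_right (by linarith) hL4.le
    _ ≤ _ := hfloor

end Summit.HubbardSuperconductivity.HubbardSuperconductivity.Theorems
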